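import Summits.QuantumFields.YangMills.Theses.SourcedPressureJensen
import Literature.MathematicalPhysics.QuantumFieldTheory.BalabanBlockSpecification

/-!
# Route `SourcedPressureJensen`, crux `JensenFloor` (stmt-QuantumFields-22518), line «birth»: TOOLKIT of the two stubs

Shared bookkeeping for `stub_jensen` (Jensen on the torus) and `stub_centredSum` (translation invariance + centring) of the
registered skeleton `Cruxes/JensenFloor/Lines/birth.lean` — the "formal risks" named by the item (integrability of the source and of
its exponential for the Bochner `wilsonExpectation`, Jensen for the torus Wilson probability measure, torus-translation invariance of
`wilsonExpectation ∘ toTorusObservable ∘ configShift`), discharged once: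

* `integrable_of_continuous` — every continuous real function on the (compact) torus configuration space `GaugeConfig 4 L G` is
  integrable for the torus Wilson state of a lattice representation `r` (a probability measure, `isProbabilityMeasure_wilsonMeasure`;
  second countability of `G` from the faithful representation `r`, tree `LatticeRep.secondCountableTopology`);
* `wilsonExpectation_le_log_wilsonExpectation_exp` — JENSEN: `E[g] ≤ log E[e^{g}]` for continuous `g` (`ConvexOn.map_integral_le`);
* `wilsonExpectation_toTorusObservable_configShift` / `…_timeShiftLG` — translation invariance in lifted form;
* `wilsonExpectation_sum_translates` — `E[Σ_{x ∈ Λ} g ∘ τ_x] = |Λ| · E[g]`, `|Λ_{L+1}| = (L+1)⁴`;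
* `wilsonExpectation_centred_mul` — `E[(a f − b)(a g − b)] = a² E[fg] − ab E[f] − ab E[g] + b²`;
* continuity of the lifted plaquette cost and of its translates.

Written by the width seat 3/3 of line `ym-line-spj-p1` as `--supports stmt-QuantumFields-22518`; it restates no stub.
HONEST LABEL: bookkeeping below the RECORD-label rung R2ξ-G (`XiPow`); nothing here bears on the Clay mass gap.
-/

set_option autoImplicit false

noncomputable section

open MeasureTheory Filter Topology
open Literature.MathematicalPhysics.QuantumFieldTheory Literature.MathematicalPhysics.QuantumLattice
open Summit.QuantumFields.YangMills.Theorems.WeakCouplingRates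

namespace Summit.QuantumFields.YangMills.Theorems.SourcedPressureJensen

variable {G : Type} [Group G] [TopologicalSpace G] [IsTopologicalGroup G] [CompactSpace G]
  [MeasurableSpace G] [BorelSpace G]

omit [Group G] [IsTopologicalGroup G] [CompactSpace G] [BorelSpace G] in
/-- Translations `configShift v` of `ℤ⁴` gauge configurations are continuous (product topology). -/
theorem continuous_configShift (v : Literature.Probability.LatticeModels.Site 4) :
    Continuous (configShift (d := 4) (G := G) v) := by
  refine continuous_pi fun e => ?_
  simp only [configShift_apply]
  exact continuous_apply _

omit [Group G] [IsTopologicalGroup G] [CompactSpace G] [MeasurableSpace G] [BorelSpace G] in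
/-- The periodic lift of a continuous observable of `ℤ⁴` configurations is continuous on torus configurations. -/
theorem continuous_toTorusObservable {L : ℕ} {F : LGConfig 4 G → ℝ} (hF : Continuous F) :
    Continuous (toTorusObservable L F) :=
  hF.comp (continuous_torusLift L)

omit [MeasurableSpace G] [BorelSpace G] in
/-- The plaquette cost `c = N − Re tr r(U_p)` of the origin `(1,2)` plaquette is continuous. -/
theorem continuous_plaqCost0 (r : LatticeRep G) : Continuous (plaqCost0 (d := 4) (G := G) r.ρ 1 2) :=
  (continuous_bounded_plaqCost0 r.ρ r.continuous 1 2).1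

omit [BorelSpace G] in
/-- The centred two-plaquette source density at `x`,
`V ↦ (β c(τ_{-x} V) − β m)(β c(α_n τ_{-x} V) − β m)`, is continuous. -/
theorem continuous_sourceDensity (r : LatticeRep G) (β m : ℝ) (n : ℕ) (v : Literature.Probability.LatticeModels.Site 4) :
    Continuous fun V : LGConfig 4 G =>
      (β * plaqCost0 (d := 4) r.ρ 1 2 (configShift v V) - m) *
        (β * plaqCost0 (d := 4) r.ρ 1 2 (timeShiftLG (G := G) n (configShift v V)) - m) := by
  have hc := continuous_plaqCost0 r
  have hs := continuous_configShift (G := G) v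
  exact ((continuous_const.mul (hc.comp hs)).sub continuous_const).mul
    ((continuous_const.mul (hc.comp ((continuous_timeShiftLG n).comp hs))).sub continuous_const)

/-- **Integrability is free on the torus**: a continuous real function on the compact configuration space `GaugeConfig 4 L G`
is integrable for the torus Wilson state of a lattice representation. -/
theorem integrable_of_continuous (r : LatticeRep G) (β : ℝ) {L : ℕ} [NeZero L]
    {f : GaugeConfig 4 L G → ℝ} (hf : Continuous f) :
    Integrable f (wilsonMeasure (d := 4) (L := L) r.ρ β) := by
  haveI := r.secondCountableTopology
  haveI := isProbabilityMeasure_wilsonMeasure (d := 4) (L := L) (G := G) r.ρ r.continuous β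
  exact hf.integrable_of_hasCompactSupport (HasCompactSupport.of_compactSpace f)

/-- Linearity: `E[c · f] = c · E[f]` (no integrability needed). -/
theorem wilsonExpectation_const_mul {N : ℕ} (ρ : G →* Matrix (Fin N) (Fin N) ℂ) (β : ℝ) {L : ℕ} [NeZero L]
    (c : ℝ) (f : GaugeConfig 4 L G → ℝ) :
    wilsonExpectation ρ β (fun U => c * f U) = c * wilsonExpectation ρ β f :=
  integral_const_mul c f

/-- **JENSEN on the torus**: `E[g] ≤ log E[e^{g}]` for a continuous `g` and the torus Wilson state (a probability measure) —
convexity of `exp` (`ConvexOn.map_integral_le`) and monotonicity of `log`. -/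
theorem wilsonExpectation_le_log_wilsonExpectation_exp (r : LatticeRep G) (β : ℝ) {L : ℕ} [NeZero L]
    {g : GaugeConfig 4 L G → ℝ} (hg : Continuous g) :
    wilsonExpectation r.ρ β g ≤ Real.log (wilsonExpectation r.ρ β fun U => Real.exp (g U)) := by
  haveI := isProbabilityMeasure_wilsonMeasure (d := 4) (L := L) (G := G) r.ρ r.continuous β
  have hgi := integrable_of_continuous r β hg
  have hei : Integrable (fun U => Real.exp (g U)) (wilsonMeasure (d := 4) (L := L) r.ρ β) :=
    integrable_of_continuous r β (Real.continuous_exp.comp hg)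
  unfold wilsonExpectation
  rw [Real.le_log_iff_exp_le (integral_exp_pos hei)]
  exact convexOn_exp.map_integral_le Real.continuous_exp.continuousOn isClosed_univ
    (ae_of_all _ fun _ => Set.mem_univ _) hgi hei

/-- Translation invariance in lifted form: `E[(F ∘ τ_v)^{Λ}] = E[F^{Λ}]`. -/
theorem wilsonExpectation_toTorusObservable_configShift {N : ℕ} (ρ : G →* Matrix (Fin N) (Fin N) ℂ) (β : ℝ)
    {L : ℕ} [NeZero L] (F : LGConfig 4 G → ℝ) (v : Literature.Probability.LatticeModels.Site 4) :
    wilsonExpectation ρ β (toTorusObservable L fun V => F (configShift v V)) =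
      wilsonExpectation ρ β (toTorusObservable L F) := by
  have h : (fun V => F (configShift v V)) = F ∘ configShift v := rfl
  rw [h, toTorusObservable_comp_configShift, wilsonExpectation_comp_torusConfigShift]

/-- Time-translation invariance in lifted form: `E[(F ∘ α_n)^{Λ}] = E[F^{Λ}]`. -/
theorem wilsonExpectation_toTorusObservable_timeShiftLG {N : ℕ} (ρ : G →* Matrix (Fin N) (Fin N) ℂ) (β : ℝ)
    {L : ℕ} [NeZero L] (F : LGConfig 4 G → ℝ) (n : ℕ) :
    wilsonExpectation ρ β (toTorusObservable L fun V => F (timeShiftLG (G := G) n V)) =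
      wilsonExpectation ρ β (toTorusObservable L F) :=
  wilsonExpectation_toTorusObservable_configShift ρ β F _

/-- Finite sums of continuous observables commute with the expectation. -/
theorem wilsonExpectation_finset_sum (r : LatticeRep G) (β : ℝ) {L : ℕ} [NeZero L] {ι : Type*} (s : Finset ι)
    (f : ι → GaugeConfig 4 L G → ℝ) (hf : ∀ i ∈ s, Continuous (f i)) :
    wilsonExpectation r.ρ β (fun U => ∑ i ∈ s, f i U) = ∑ i ∈ s, wilsonExpectation r.ρ β (f i) := by
  unfold wilsonExpectation
  exact integral_finsetSum s fun i hi => integrable_of_continuous r β (hf i hi)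

/-- **TRANSLATION AVERAGE**: `E[Σ_{x ∈ Λ_{L+1}} (g ∘ τ_{-x})^{Λ}] = (L+1)⁴ · E[g^{Λ}]` for continuous `g`. -/
theorem wilsonExpectation_sum_translates (r : LatticeRep G) (β : ℝ) (L : ℕ) {g : LGConfig 4 G → ℝ}
    (hg : Continuous g) :
    wilsonExpectation (L := L + 1) r.ρ β (fun U =>
        ∑ x : Fin 4 → Fin (L + 1), toTorusObservable (L + 1) (fun V => g (configShift (fun i => -((x i : ℕ) : ℤ)) V)) U) =
      ((L + 1 : ℝ) ^ 4) * wilsonExpectation (L := L + 1) r.ρ β (toTorusObservable (L + 1) g) := by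
  have hcont : ∀ x : Fin 4 → Fin (L + 1),
      Continuous (toTorusObservable (G := G) (L + 1) fun V => g (configShift (fun i => -((x i : ℕ) : ℤ)) V)) :=
    fun x => continuous_toTorusObservable (hg.comp (continuous_configShift _))
  have hterm : ∀ x : Fin 4 → Fin (L + 1),
      wilsonExpectation (L := L + 1) r.ρ β (toTorusObservable (L + 1) fun V => g (configShift (fun i => -((x i : ℕ) : ℤ)) V)) =
        wilsonExpectation (L := L + 1) r.ρ β (toTorusObservable (L + 1) g) :=
    fun x => wilsonExpectation_toTorusObservable_configShift r.ρ β g _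
  have hsum := wilsonExpectation_finset_sum r β (Finset.univ : Finset (Fin 4 → Fin (L + 1)))
    (fun x => toTorusObservable (L + 1) fun V => g (configShift (fun i => -((x i : ℕ) : ℤ)) V)) fun x _ => hcont x
  rw [hsum, Finset.sum_congr rfl fun x _ => hterm x, Finset.sum_const, Finset.card_univ, Fintype.card_fun,
    Fintype.card_fin, Fintype.card_fin, nsmul_eq_mul]
  push_cast
  ring

/-- **CENTRED PRODUCT**: `E[(a f − b)(a g − b)] = a² E[fg] − ab E[f] − ab E[g] + b²` for continuous `f, g`. -/
theorem wilsonExpectation_centred_mul (r : LatticeRep G) (β : ℝ) {L : ℕ} [NeZero L]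
    {f g : GaugeConfig 4 L G → ℝ} (hf : Continuous f) (hg : Continuous g) (a b : ℝ) :
    wilsonExpectation r.ρ β (fun U => (a * f U - b) * (a * g U - b)) =
      a ^ 2 * wilsonExpectation r.ρ β (fun U => f U * g U) - a * b * wilsonExpectation r.ρ β f -
        a * b * wilsonExpectation r.ρ β g + b ^ 2 := by
  haveI := isProbabilityMeasure_wilsonMeasure (d := 4) (L := L) (G := G) r.ρ r.continuous β
  have hfg := integrable_of_continuous r β (hf.mul hg)
  have hfi := integrable_of_continuous r β hf
  have hgi := integrable_of_continuous r β hg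
  have h1 : Integrable (fun U => a ^ 2 * (f U * g U)) (wilsonMeasure (d := 4) (L := L) r.ρ β) := hfg.const_mul _
  have h2 : Integrable (fun U => a * b * f U) (wilsonMeasure (d := 4) (L := L) r.ρ β) := hfi.const_mul _
  have h3 : Integrable (fun U => a * b * g U) (wilsonMeasure (d := 4) (L := L) r.ρ β) := hgi.const_mul _
  have h12 : Integrable (fun U => a ^ 2 * (f U * g U) - a * b * f U) (wilsonMeasure (d := 4) (L := L) r.ρ β) :=
    h1.sub h2
  have h123 : Integrable (fun U => a ^ 2 * (f U * g U) - a * b * f U - a * b * g U)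
      (wilsonMeasure (d := 4) (L := L) r.ρ β) := h12.sub h3
  have h4 : Integrable (fun _ : GaugeConfig 4 L G => b ^ 2) (wilsonMeasure (d := 4) (L := L) r.ρ β) :=
    integrable_const _
  have hexp : (fun U => (a * f U - b) * (a * g U - b)) =
      fun U => a ^ 2 * (f U * g U) - a * b * f U - a * b * g U + b ^ 2 := by
    funext U; ring
  unfold wilsonExpectation
  beta_reduce
  rw [hexp, integral_add h123 h4, integral_sub h12 h3, integral_sub h1 h2,
    integral_const_mul, integral_const_mul, integral_const_mul, integral_const, probReal_univ, one_smul]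

end Summit.QuantumFields.YangMills.Theorems.SourcedPressureJensen

end
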